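import Literature.Analysis.FluidPDE.PassiveScalarDriftStability
import Literature.Analysis.FluidPDE.ReleaseLogBoundSmooth
import Literature.Analysis.Calculus.CutoffDataEnergy
import Summits.AnomalousDissipation.AnomalousDissipation.Theorems.SawtoothPulseCascadeK3LocalisedClosureForceBound
import Summits.AnomalousDissipation.AnomalousDissipation.Theorems.SawtoothPulseCascadeK3LocalisedClosureEnergyFloor

/-!
# K3loc, line `DriftFree` — STUB `stub_driftFreeClosure` (S5): the drift-free closure bookkeeping

Sorry-free proof of the registered stub `stub_driftFreeClosure` of the line `DriftFree` (skeleton v3, lead) of the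
crux `Summit.AnomalousDissipation.AnomalousDissipation.Theses.SawtoothPulseCascade.K3LocalisedClosure`
(stmt-AnomalousDissipation-19492), on the vocabulary `Literature/Analysis/FluidPDE/SawtoothCascadeDriftFree`:

  `K1LocalisedCascade → (∀ box, Existence P) → (∀ box, ApproximateSolution P (γ² − 3)) → ∀ box, PlanarAnomalousFamily P`,
  `P = ⟨γ, 1/4, 2, 1, ρN⟩`, `γ ∈ [5,8]`, `ρN ∈ {2,…,7}`.

THE ARGUMENT (ad-ideate-p2 ROUND-4 §2.3, F3 + F4; here `planarAnomalousFamily_of` for a general parameter point).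
K1loc gives `χ > 0`, a lag `A`, `κ₀ > 0`; put `D = ‖θ₀‖²_{L²} > 0`, `ε = χ²D/96`, take `ν₀(A, ε)` from
`ApproximateSolution`, and `ν_m = min κ₀ ν₀/(m+2)` (`IsVanishingViscosity`).  For each `m` (`κ = ν_m`,
`T = horizon r κ A = tStart (J_r(κ) + A) < 1`; `T = 0` is excluded by K1loc itself): `Existence` gives the classical
planar Navier–Stokes solution `V` forced by `∂ₜū` from rest, its scalar `R` from `θ₀`, the forced weak formulation of
the lift, and the cascade scalar `w`; `ApproximateSolution` gives `U, ρ, q, Λ`.  Then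
(1) K1loc + the energy identity of `w` (`scalarL2Sq_add_scalarDissipation_holds`, `eScalarDissipation_eq_ofReal`):
`‖w(T)‖² ≤ (1 − χ) D`; (2) `DriftFree.nsEnergyStability` (tree, ad-lit p437563): `‖V(s) − U(s)‖² ≤ εκ` on `[0,T]`,
hence with `∫₀ᵀ‖U − ū‖² ≤ εκ`: `∫₀ᵀ∫‖V − ū‖² ≤ 4εκ`; (3) Johansson–Sorella Lemma 2.2
(`integral_sub_sq_add_dissipation_le_of_drifts_init`, `|θ₀| ≤ 1`): `‖R(T) − w(T)‖² ≤ 4ε`; (4)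
`‖R(T)‖² ≤ (1 + χ/2)‖w(T)‖² + (1 + 2/χ)‖R(T) − w(T)‖² ≤ D − (5χ/12) D`; (5) energy identity of `R`:
`κ∫₀ᵀ‖∇R‖² ≥ (5χ/24) D ≥ χD/8`; (6) the `2½`-D dissipation floor (helper `EnergyFloor`, which needs the force sup
bound of helper `ForceBound`): `κ∫₀ᵀ‖∇R‖² ≤ cumulativeDissipation κ ((V,R)∘π) 0 1`.  Hence
`HasAnomalousDissipation` with `ε' = χD/8`, for every `m`.
References: Johansson–Sorella arXiv:2409.03599 Lemma 2.2 and §10; Grenier CPAM 53 (2000) §2; Majda–Bertozzi 2002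
§3.1.1; Cheskidov 2023 §6.
-/

-- `Summit.<Summit>.<Problem>`: single-conjunct summit, the duplicate namespace segment is deliberate.
set_option linter.dupNamespace false

noncomputable section

namespace Summit.AnomalousDissipation.AnomalousDissipation.Theorems.SawtoothPulseCascade.DriftFreeClosure

open scoped InnerProductSpace ENNReal NNReal
open MeasureTheory Set Filter Topology
open Literature.Analysis Literature.Analysis.FunctionSpaces Literature.Analysis.FluidPDE
open Literature.Analysis.FluidPDE.SawtoothCascade
open Literature.Analysis.FluidPDE.SawtoothCascade.DriftFree
open Literature.Analysis.FunctionSpaces.Torus (twoHalf planarProj)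
open Summit.AnomalousDissipation.AnomalousDissipation.Theses.SawtoothPulseCascade

/-! ## §5 The drift-free closure at one parameter point -/

section Closure

/-- A vanishing-viscosity sequence below two thresholds: `ν_m = min κ₀ ν₀ / (m + 2)`. [folklore] -/
theorem isVanishingViscosity_min_div {κ₀ ν₀ : ℝ} (hκ₀ : 0 < κ₀) (hν₀ : 0 < ν₀) :
    IsVanishingViscosity (fun m : ℕ => min κ₀ ν₀ / ((m : ℝ) + 2)) ∧
      ∀ m : ℕ, min κ₀ ν₀ / ((m : ℝ) + 2) ≤ κ₀ ∧ min κ₀ ν₀ / ((m : ℝ) + 2) ≤ ν₀ := by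
  have hc : 0 < min κ₀ ν₀ := lt_min hκ₀ hν₀
  refine ⟨⟨?_, ?_, fun m => by positivity⟩, fun m => ?_⟩
  · intro m n hmn
    exact div_lt_div_of_pos_left hc (by positivity) (by exact_mod_cast Nat.add_lt_add_right hmn 2)
  · have h1 : Tendsto (fun m : ℕ => 1 / ((m : ℝ) + 2)) atTop (𝓝 0) := by
      have h := tendsto_one_div_add_atTop_nhds_zero_nat (𝕜 := ℝ)
      have h' : Tendsto (fun i : ℕ => 1 / ((↑(i + 1) : ℝ) + 1)) atTop (𝓝 0) :=
        h.comp (tendsto_add_atTop_nat 1)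
      refine h'.congr fun i => ?_
      push_cast; ring_nf
    have := h1.const_mul (min κ₀ ν₀)
    rw [mul_zero] at this
    refine this.congr fun m => ?_
    ring
  · have h2 : (2 : ℝ) ≤ (m : ℝ) + 2 := by
      have : (0 : ℝ) ≤ m := Nat.cast_nonneg m; linarith
    have hle : min κ₀ ν₀ / ((m : ℝ) + 2) ≤ min κ₀ ν₀ := by
      rw [div_le_iff₀ (by positivity)]
      nlinarith
    exact ⟨hle.trans (min_le_left _ _), hle.trans (min_le_right _ _)⟩

/-- **The drift-free closure at one parameter point.**  If the cascade field of `P` is smooth on `[0,1)`, the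
localised scalar crux `K1Localised P r` holds, the existence package `Existence P` holds, the approximate
solution `ApproximateSolution P r` exists, and the force `∂ₜū` is bounded on `[0,1) × 𝕋²`, then
`PlanarAnomalousFamily P`: along `ν_m = min κ₀ ν₀/(m+2)` the lifts `(V_m, R_m)∘π` dissipate at least
`χ‖θ₀‖²/8` — Johansson–Sorella Lemma 2.2 (drift-free scalar comparison on `[0, T_A(ν)]`, cost
`(1/ν)∫₀ᵀ‖V − ū‖² ≤ 4ε` by `NSEnergyStability` + `ApproximateSolution`), the energy identities of `θ̄` and `θ^V`,
and `‖∇u‖² ≥ ‖∇θ^V‖²` for the lift. [folklore] -/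
theorem planarAnomalousFamily_of {P : CascadeParams} {r : ℝ} (hfs : CascadeFieldSmooth P)
    (hK1 : K1Localised P r) (hEx : Existence P) (hApp : ApproximateSolution P r) {C : ℝ}
    (hC : ∀ t ∈ Ico (0 : ℝ) 1, ∀ y, ‖planarForce P t y‖ ≤ C) : PlanarAnomalousFamily P := by
  obtain ⟨χ, hχ, A, κ₀, hκ₀, hK⟩ := hK1
  set D : ℝ := FluidPDE.Torus.scalarL2Sq datum with hDdef
  have hD : 0 < D := scalarL2Sq_datum_pos
  set ε : ℝ := χ ^ 2 * D / 96 with hεdef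
  have hε : 0 < ε := by positivity
  obtain ⟨ν₀, hν₀, hAS⟩ := hApp A ε hε
  obtain ⟨hvan, hνle⟩ := isVanishingViscosity_min_div hκ₀ hν₀
  set ν : ℕ → ℝ := fun m => min κ₀ ν₀ / ((m : ℝ) + 2) with hνdef
  have hνpos : ∀ m, 0 < ν m := hvan.2.2
  have hE := fun m => hEx (ν m) (hνpos m)
  choose V φ R hV hV0 hR hR0 hweak using fun m => (hE m).1
  choose w hw hw0 using fun m => (hE m).2
  refine ⟨ν, hvan, V, φ, R, fun m => ⟨hV m, hV0 m, hR m, hR0 m, hweak m⟩, ?_⟩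
  refine ⟨χ * D / 8, by positivity, Eventually.of_forall fun m => ?_⟩
  -- fix `m`; write `κ = ν m`, `T = horizon r κ A`
  have hκpos : 0 < ν m := hνpos m
  have hκκ₀ : ν m ≤ κ₀ := (hνle m).1
  have hκν₀ : ν m ≤ ν₀ := (hνle m).2
  set κ := ν m with hκdef
  set T := horizon r κ A with hTdef
  have hT0 : 0 ≤ T := CascadeParams.tStart_nonneg _
  have hT1 : T < 1 := CascadeParams.tStart_lt_one _
  have hTI : T ∈ Ico (0 : ℝ) 1 := ⟨hT0, hT1⟩
  have hI : Icc 0 T ⊆ Ico (0 : ℝ) 1 := fun s hs => ⟨hs.1, hs.2.trans_lt hT1⟩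
  have hU1 : UniqueDiffOn ℝ (Ico (0 : ℝ) 1) := uniqueDiffOn_Ico 0 1
  have hconv : Convex ℝ (Ico (0 : ℝ) 1) := convex_Ico 0 1
  -- (0) the floor: `κ∫₀ᵀ‖∇R‖² ≤ cumulativeDissipation`
  have hfloor := scalar_dissipation_le_cumulativeDissipation_twoHalf hκpos (hV m) (hV0 m) hC (hR m) hTI
  refine le_trans ?_ hfloor
  -- (1) K1loc for the cascade scalar `w m`
  have hK1w := hK κ ⟨hκpos, hκκ₀⟩ (w m) (hw m) (hw0 m)
  -- the case `T = 0` is excluded by K1loc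
  rcases eq_or_lt_of_le hT0 with hT00 | hTpos
  · exfalso
    have hz : FluidPDE.Torus.eScalarDissipation κ (w m) 0 (CascadeParams.tStart (Jrate r κ + A)) = 0 := by
      show FluidPDE.Torus.eScalarDissipation κ (w m) 0 T = 0
      rw [← hT00]; simp [FluidPDE.Torus.eScalarDissipation]
    rw [hz, mul_zero, nonpos_iff_eq_zero, ENNReal.ofReal_eq_zero] at hK1w
    have : 0 < χ * FluidPDE.Torus.scalarL2Sq datum := mul_pos hχ hD
    linarith
  have hwI := (hw m).restrict_Icc hTpos hI
  have hed : FluidPDE.Torus.eScalarDissipation κ (w m) 0 T =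
      ENNReal.ofReal (FluidPDE.Torus.scalarDissipation κ (w m) 0 T) :=
    FluidPDE.Torus.eScalarDissipation_eq_ofReal hκpos.le hTpos hwI
  have hsd0 : 0 ≤ FluidPDE.Torus.scalarDissipation κ (w m) 0 T :=
    FluidPDE.Torus.scalarDissipation_nonneg hκpos.le _ hT0
  have hK1' : χ * D ≤ 2 * FluidPDE.Torus.scalarDissipation κ (w m) 0 T := by
    have h := hK1w
    change ENNReal.ofReal (χ * FluidPDE.Torus.scalarL2Sq datum) ≤ 2 * FluidPDE.Torus.eScalarDissipation κ (w m) 0 T at h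
    rw [hed, ← ENNReal.ofReal_ofNat 2, ← ENNReal.ofReal_mul (by norm_num)] at h
    exact (ENNReal.ofReal_le_ofReal_iff (by positivity)).1 h
  have hwen := FluidPDE.Torus.IsClassicalScalarTransportOn.scalarL2Sq_add_scalarDissipation_holds (hw m) hT0 hI
  rw [hw0 m] at hwen
  -- ‖w(T)‖² ≤ (1 - χ) D
  have hwT : FluidPDE.Torus.scalarL2Sq (w m T) ≤ D - χ * D := by linarith
  -- (2) closeness of the drifts: ∫₀ᵀ ∫‖V − ū‖² ≤ 4 ε κ
  obtain ⟨U, ρ, q, Λ, hU, hU0, hStr, hΛc, hρc, hUc, hUint, hdef⟩ := hAS κ ⟨hκpos, hκν₀⟩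
  have hVU : ∀ s ∈ Icc 0 T, FluidPDE.Torus.vectorL2Sq (V m s - U s) ≤ ε * κ := by
    intro s hs
    have h1 := nsEnergyStability (Ico (0 : ℝ) 1) κ T (planarForce P) ρ U (V m) q (φ m) Λ hκpos.le hT0
      hconv hI hU (hV m) (by rw [hU0, hV0 m]) hStr hΛc hρc s hs
    have h2 : FluidPDE.Torus.vectorL2Sq (V m s - U s) = Real.sqrt (FluidPDE.Torus.vectorL2Sq (V m s - U s)) ^ 2 :=
      (Real.sq_sqrt (integral_nonneg fun _ => sq_nonneg _)).symm
    rw [h2]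
    exact (pow_le_pow_left₀ (Real.sqrt_nonneg _) h1 2).trans (hdef s hs)
  have hVs := (hV m).smooth_velocity
  have hUs := hU.smooth_velocity
  have hdiff : ∀ s ∈ Icc 0 T, (∫ x, ‖V m s x - P.field s x‖ ^ 2) ≤
      2 * (ε * κ) + 2 * FluidPDE.Torus.vectorL2Sq (U s - P.field s) := by
    intro s hs
    have hs' : s ∈ Ico (0 : ℝ) 1 := hI hs
    have cV : Continuous (V m s) := (hVs.isSmooth_slice hs').continuous
    have cU : Continuous (U s) := (hUs.isSmooth_slice hs').continuous
    have cF : Continuous (P.field s) := (hfs.isSmooth_slice hs').continuous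
    have hpt : ∀ x, ‖V m s x - P.field s x‖ ^ 2 ≤ 2 * ‖V m s x - U s x‖ ^ 2 + 2 * ‖U s x - P.field s x‖ ^ 2 := by
      intro x
      have e : V m s x - P.field s x = (V m s x - U s x) + (U s x - P.field s x) := by abel
      rw [e]
      have h := norm_add_le (V m s x - U s x) (U s x - P.field s x)
      have h2 := pow_le_pow_left₀ (norm_nonneg _) h 2
      nlinarith [sq_nonneg (‖V m s x - U s x‖ - ‖U s x - P.field s x‖)]
    have c0 : Continuous fun x => ‖V m s x - P.field s x‖ ^ 2 := by fun_prop
    have c1 : Continuous fun x => 2 * ‖V m s x - U s x‖ ^ 2 := by fun_prop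
    have c2 : Continuous fun x => 2 * ‖U s x - P.field s x‖ ^ 2 := by fun_prop
    calc (∫ x, ‖V m s x - P.field s x‖ ^ 2)
        ≤ ∫ x, (2 * ‖V m s x - U s x‖ ^ 2 + 2 * ‖U s x - P.field s x‖ ^ 2) :=
          integral_mono c0.integrable_unitAddTorus (c1.add c2).integrable_unitAddTorus hpt
      _ = 2 * FluidPDE.Torus.vectorL2Sq (V m s - U s) + 2 * FluidPDE.Torus.vectorL2Sq (U s - P.field s) := by
          rw [integral_add c1.integrable_unitAddTorus c2.integrable_unitAddTorus,
            integral_const_mul, integral_const_mul]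
          simp only [FluidPDE.Torus.vectorL2Sq, Pi.sub_apply]
      _ ≤ 2 * (ε * κ) + 2 * FluidPDE.Torus.vectorL2Sq (U s - P.field s) := by
          linarith [hVU s hs]
  have hdc : ContinuousOn (fun s => ∫ x, ‖V m s x - P.field s x‖ ^ 2) (Icc 0 T) :=
    ((hVs.sub hfs).continuousOn_integral_norm_sq hconv).mono hI
  have hTsub : uIcc 0 T ⊆ Icc 0 T := by rw [uIcc_of_le hT0]
  have hdrift : ∫ s in (0 : ℝ)..T, ∫ x, ‖V m s x - P.field s x‖ ^ 2 ≤ 4 * ε * κ := by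
    have i1 : IntervalIntegrable (fun s => ∫ x, ‖V m s x - P.field s x‖ ^ 2) volume 0 T :=
      (hdc.mono hTsub).intervalIntegrable
    have i2 : IntervalIntegrable (fun s => 2 * (ε * κ) + 2 * FluidPDE.Torus.vectorL2Sq (U s - P.field s)) volume 0 T :=
      intervalIntegrable_const.add ((hUc.mono hTsub).intervalIntegrable.const_mul 2)
    have h1 := intervalIntegral.integral_mono_on hT0 i1 i2 hdiff
    rw [intervalIntegral.integral_add intervalIntegrable_const ((hUc.mono hTsub).intervalIntegrable.const_mul 2),
      intervalIntegral.integral_const, intervalIntegral.integral_const_mul, smul_eq_mul] at h1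
    have hT1' : T - 0 ≤ 1 := by linarith
    have hεκ : 0 ≤ ε * κ := by positivity
    nlinarith [hUint]
  -- (3) Johansson–Sorella Lemma 2.2: ‖R(T) − w(T)‖² ≤ 4ε
  have hJS := (hR m).integral_sub_sq_add_dissipation_le_of_drifts_init (hw m) hκpos hI
    (by rw [hR0 m, hw0 m]) (M := 1) (fun x => by rw [hw0 m]; exact abs_datum_le_one x)
    (t := T) ⟨hT0, le_rfl⟩
  have hdis0 : 0 ≤ κ * ∫ s in (0 : ℝ)..T, FluidPDE.Torus.scalarGradNormSq (R m s - w m s) :=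
    mul_nonneg hκpos.le (intervalIntegral.integral_nonneg hT0 fun s _ => FluidPDE.Torus.scalarGradNormSq_nonneg _)
  have hRw : ∫ x, (R m T x - w m T x) ^ 2 ≤ 4 * ε := by
    have : (1 : ℝ) ^ 2 / κ * ∫ s in (0 : ℝ)..T, ∫ x, ‖V m s x - P.field s x‖ ^ 2 ≤ 4 * ε := by
      rw [one_pow, div_mul_eq_mul_div, one_mul, div_le_iff₀ hκpos]
      linarith
    linarith
  -- (4) ‖R(T)‖² ≤ (1 + χ/2)‖w(T)‖² + (1 + 2/χ)‖R(T) − w(T)‖²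
  have hRTs : FunctionSpaces.Torus.IsSmooth (R m T) := (hR m).smooth_scalar.isSmooth_slice hTI
  have hwTs : FunctionSpaces.Torus.IsSmooth (w m T) := (hw m).smooth_scalar.isSmooth_slice hTI
  have cR := hRTs.continuous
  have cw := hwTs.continuous
  have hη : 0 < χ / 2 := by positivity
  have hsplit : FluidPDE.Torus.scalarL2Sq (R m T) ≤
      (1 + χ / 2) * FluidPDE.Torus.scalarL2Sq (w m T) + (1 + (χ / 2)⁻¹) * ∫ x, (R m T x - w m T x) ^ 2 := by
    unfold FluidPDE.Torus.scalarL2Sq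
    have c0 : Continuous fun x => (w m T x + (R m T x - w m T x)) ^ 2 := by fun_prop
    have c1 : Continuous fun x => (1 + χ / 2) * w m T x ^ 2 := by fun_prop
    have c2 : Continuous fun x => (1 + (χ / 2)⁻¹) * (R m T x - w m T x) ^ 2 := by fun_prop
    calc (∫ x, R m T x ^ 2) = ∫ x, (w m T x + (R m T x - w m T x)) ^ 2 := by
          congr 1; funext x; ring
      _ ≤ ∫ x, ((1 + χ / 2) * w m T x ^ 2 + (1 + (χ / 2)⁻¹) * (R m T x - w m T x) ^ 2) :=
          integral_mono c0.integrable_unitAddTorus (c1.add c2).integrable_unitAddTorus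
            fun x => Literature.Analysis.Calculus.add_sq_le_weighted hη _ _
      _ = (1 + χ / 2) * (∫ x, w m T x ^ 2) + (1 + (χ / 2)⁻¹) * ∫ x, (R m T x - w m T x) ^ 2 := by
          rw [integral_add c1.integrable_unitAddTorus c2.integrable_unitAddTorus, integral_const_mul,
            integral_const_mul]
  -- (5) arithmetic: ‖R(T)‖² ≤ D − (5/12) χ D
  have hRT : FluidPDE.Torus.scalarL2Sq (R m T) ≤ D - 5 / 12 * (χ * D) := by
    have hχinv : (χ / 2)⁻¹ = 2 / χ := by rw [inv_div]
    rw [hχinv] at hsplit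
    have h1 : (1 + χ / 2) * FluidPDE.Torus.scalarL2Sq (w m T) ≤ (1 + χ / 2) * (D - χ * D) :=
      mul_le_mul_of_nonneg_left hwT (by positivity)
    have h2 : (1 + 2 / χ) * (∫ x, (R m T x - w m T x) ^ 2) ≤ (1 + 2 / χ) * (4 * ε) :=
      mul_le_mul_of_nonneg_left hRw (by positivity)
    have h3 : (1 + 2 / χ) * (4 * ε) = (χ ^ 2 + 2 * χ) * D / 24 := by
      simp only [hεdef]; field_simp; ring
    have h4 : (1 + χ / 2) * (D - χ * D) + (χ ^ 2 + 2 * χ) * D / 24 ≤ D - 5 / 12 * (χ * D) := by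
      nlinarith [mul_pos (mul_pos hχ hχ) hD]
    linarith
  -- (6) energy identity for `R`: κ∫₀ᵀ‖∇R‖² = (D − ‖R(T)‖²)/2 ≥ χ D / 8
  have hRen := FluidPDE.Torus.IsClassicalScalarTransportOn.scalarL2Sq_add_scalarDissipation_holds (hR m) hT0 hI
  rw [hR0 m] at hRen
  simp only [FluidPDE.Torus.scalarDissipation] at hRen
  change χ * D / 8 ≤ κ * ∫ s in (0 : ℝ)..T, FluidPDE.Torus.scalarGradNormSq (R m s)
  nlinarith [mul_pos hχ hD]

end Closure


/-! ## §6 The registered stub on the box -/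

/-- **STUB `stub_driftFreeClosure`** (line `DriftFree`, crux K3loc stmt-AnomalousDissipation-19492; lead reshape v3:
the toolkit hypothesis `NSEnergyStability` is the tree theorem `DriftFree.nsEnergyStability` and is used inside, and
the box statements are spelled with the literal parameter point `⟨γ, 1/4, 2, 1, ρN⟩`).  The localised scalar crux
`K1LocalisedCascade`, the existence package on the box and the approximate solutions on the box at rate `γ² − 3` give
the planar anomalous family at every box point — `planarAnomalousFamily_of` with the force bound
`exists_norm_planarForce_le` (`δ₀ = 1/4 > 0`, `d = 2 > 0`, `N₀ = 1`, `ρN ≥ 2`). [folklore] -/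
theorem stub_driftFreeClosure :
    K1LocalisedCascade →
    (∀ γ ∈ Icc (5 : ℝ) 8, ∀ ρN ∈ Finset.Icc 2 7, Existence ⟨γ, 1 / 4, 2, 1, ρN⟩) →
    (∀ γ ∈ Icc (5 : ℝ) 8, ∀ ρN ∈ Finset.Icc 2 7, ApproximateSolution ⟨γ, 1 / 4, 2, 1, ρN⟩ (γ ^ 2 - 3)) →
      ∀ γ ∈ Icc (5 : ℝ) 8, ∀ ρN ∈ Finset.Icc 2 7, PlanarAnomalousFamily ⟨γ, 1 / 4, 2, 1, ρN⟩ := by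
  intro hK1 hEx hApp γ hγ ρN hρN
  obtain ⟨hfs, hloc⟩ := hK1 γ hγ ρN hρN
  have hρ2 : 2 ≤ ρN := (Finset.mem_Icc.1 hρN).1
  obtain ⟨C, hC⟩ := exists_norm_planarForce_le ⟨γ, 1 / 4, 2, 1, ρN⟩ (by norm_num) (by norm_num) le_rfl hρ2
  exact planarAnomalousFamily_of hfs hloc (hEx γ hγ ρN hρN) (hApp γ hγ ρN hρN) hC
end Summit.AnomalousDissipation.AnomalousDissipation.Theorems.SawtoothPulseCascade.DriftFreeClosure

end
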